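import Summits.HodgeConjecture.HodgeConjecture.Theorems.K2E3NormalizedCharBddNearSemisimpleDescent   -- ★ p855084 (this seat): `normalizedCharBddNear_of_slice`
import Summits.HodgeConjecture.HodgeConjecture.Theorems.K2E3CharpolyDiscrSmul                       -- ★ p855228 (this seat): `unit_mul_det_pow_eq_of_smul_cayley`
import HarnessLib

/-!
# K2 · E3 ∕ U12-d — socket #12 at a CENTRAL point reduces to a pure LIE-ALGEBRA bound: `sig_K2E3NormalizedCharBddNearSemisimple` at `s = z·1` ⟸
# «`|disc(χ_Y)|^{1∕4}·|Θ(s·c(Y))|` bounded for small skew `Y`» (Harish-Chandra on `𝔤 = 𝔲_N` itself: Thm 5.11 + Cor 6.2) + «the Cayley slice at `s` covers a neighbourhood»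

HCML Track B «K2-LIT», cell `pub/hodgecm-mathlib`, crux H413 = `stmt-HodgeConjecture-24833` (`--supports … --as helper`), seat `hodgecm-mathlib-K2E3-p12` (g0),
socket #12 `sig_K2E3NormalizedCharBddNearSemisimple` (sub-line «HC descent at a semisimple point», sub-sockets (S-abc)∕(S-d) of `K2/K2E3-p12/g0/SUBSIGS-U12d-CayleySlice.v1…`
ADOPTED by K2E3-plan (g1) for U12 ED. 3).  At a CENTRAL point `s` (matrix `z·1`, `z` a unit of `R = L ⊗ L⁺_v`) the centraliser is all of `G`, the slice is `s·c(V ∩ 𝔲)` with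
`c(Y) = (1+Y)(1−Y)⁻¹`, and [HarishChandra1999 §17] `|D_G(s·c(Y))| = |D_G(c(Y))| ≍ |η_𝔤(Y)|` becomes, in the socket's currency and for every `N`, the ★ identity
`u·(det(1−Y)·det(1+Y))^{N−1} = 2^{N(N−1)}·disc(χ_Y)` (★ `unit_mul_det_pow_eq_of_smul_cayley`, p855228 ∘ p855189).  THIS FILE turns that identity into the estimate and
composes: **`normalizedCharBddNear_central_of_lieBound`** — the socket's conclusion at `s` follows from
* (i) the LIE-ALGEBRA BOUND: `∃ V ∈ 𝓝 0, ∃ B, ∀ y, ∀ Y ∈ V` skew (`(σY)ᵀJ_v = −J_vY`), commuting with `s`, `1 ± Y` units, `y = s·c(Y)` ⟹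
  `√√(Π_w |disc(χ_Y)_w|_w) · ‖Θ y‖ ≤ B` — the group-free form of [HarishChandra1999 Thm 16.2 at a central point = Thm 5.11 on `𝔤`] + [Cor 6.2: `|η|^{1∕2}·T̂` locally
  bounded] (the remaining XXL analytic input, now stated WITHOUT the group weight), and
* (ii) the CENTRAL CAYLEY COVERING: every `g` near `s` IS `s·c(Y)` with `Y` small skew (no conjugation needed at a central point; the file
  `K2E3CayleySliceCoversNhdsCentral` dealt to K2E1b-p15 (g0)),
via ★ `normalizedCharBddNear_of_slice` (p855084) with the slice `S = {y | ∃ Y ∈ V′, …}`, where on `V′ ⊆ V` the continuous unit factor `Π_w |((det(1−Y)det(1+Y))^{N−1})_w|_w`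
stays `> 1∕2`, so that `‖u‖ ≤ 2·‖2^{N(N−1)}‖·‖disc(χ_Y)‖` and `√√‖u‖·‖Θ y‖ ≤ √√(2‖2^{N(N−1)}‖)·B`.
PROOF STRATEGY: «pinned weight through the Cayley chart» (algebra ★ + continuity; no harmonic analysis).  THEOREMS ONLY (no `def`, no instance, no notation, no `sorry`,
axioms ⊆ the trio).  HONEST LABEL: HC_CM is proved only modulo the 7 printed citations (2 remaining named inputs: hLiu418 = stmt-HodgeConjecture-24832, h413 =
stmt-HodgeConjecture-24833) until rung 0 closes; this file proves no printed analytic estimate.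

## References
* [HarishChandra1999AdmissibleDistributions] Harish-Chandra (DeBacker–Sally), *Admissible Invariant Distributions on Reductive p-adic Groups* (1999): Thm. 16.2∕16.3 p. 77,
  Thm. 5.11 p. 44, Cor. 6.2 p. 45, §17 (`|η_𝔤(X)| = |D_G(exp X)|`), §21 p. 87.
* [Rogawski1990] J. D. Rogawski, *Automorphic Representations of Unitary Groups in Three Variables* (1990), §4.9 p. 54, §12.7 p. 193.
* [PlatonovRapinchuk1994] V. Platonov, A. Rapinchuk, *Algebraic Groups and Number Theory* (1994), §3.3 (Cayley parametrisation).
-/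

set_option autoImplicit false
set_option linter.dupNamespace false

noncomputable section

open NumberField IsDedekindDomain MeasureTheory Filter Topology Polynomial
open scoped Matrix MatrixGroups NNReal
open Literature.NumberTheory.Rogawski1990 Literature.NumberTheory.Automorphic Literature.NumberTheory.Automorphic.UnitaryGroup
open Literature.NumberTheory.GaloisRepresentations Literature.NumberTheory.GaloisRepresentations.IsNonarchimedeanLocalField
open Summit.HodgeConjecture.HodgeConjecture.Cruxes.H413.K2E3NormalizedCharBddNearSemisimpleDescent
open Summit.HodgeConjecture.HodgeConjecture.Cruxes.H413.K2E3CharpolyDiscrSmul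

namespace Summit.HodgeConjecture.HodgeConjecture.Cruxes.H413.K2E3NormalizedCharBddNearCentralOfLieBound

variable (L : Type) [Field L] [NumberField L] [IsCMField L] (N : ℕ) (H : Matrix (Fin N) (Fin N) L)
  (v : HeightOneSpectrum (𝓞 ↥(maximalRealSubfield L)))

/-! ## §1 The unit factor `Π_w |((det(1−Y)·det(1+Y))^{N−1})_w|_w` is continuous and equals `1` at `Y = 0` -/

omit [IsCMField L] in
/-- Continuity of `Y ↦ Π_w |((det(1−Y)·det(1+Y))^{N−1})_w|_w` on `M_N(L ⊗ L⁺_v)` (★ `LocalFieldHaar.continuous_normAbs`, Mathlib `Continuous.matrix_det`). [folklore] -/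
theorem continuous_detFactor :
    Continuous fun Y : Matrix (Fin N) (Fin N) (UnitaryGroup.LocalRing L v) =>
      ∏ w : PlacesOver L v, normAbs (w.1.adicCompletion L) ((((1 - Y).det * (1 + Y).det) ^ (N - 1)) w) := by
  have h1 : Continuous fun Y : Matrix (Fin N) (Fin N) (UnitaryGroup.LocalRing L v) => (1 - Y).det := continuous_id.matrix_det.comp (continuous_const.sub continuous_id)
  have h2 : Continuous fun Y : Matrix (Fin N) (Fin N) (UnitaryGroup.LocalRing L v) => (1 + Y).det := continuous_id.matrix_det.comp (continuous_const.add continuous_id)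
  have h3 : Continuous fun Y : Matrix (Fin N) (Fin N) (UnitaryGroup.LocalRing L v) => ((1 - Y).det * (1 + Y).det) ^ (N - 1) := (h1.mul h2).pow _
  exact continuous_finsetProd _ fun w _ => LocalFieldHaar.continuous_normAbs.comp ((continuous_apply w).comp h3)

omit [IsCMField L] in
/-- At `Y = 0` the unit factor is `1`. [folklore] -/
theorem detFactor_zero :
    (∏ w : PlacesOver L v, normAbs (w.1.adicCompletion L) ((((1 - (0 : Matrix (Fin N) (Fin N) (UnitaryGroup.LocalRing L v))).det * (1 + (0 : Matrix (Fin N) (Fin N) (UnitaryGroup.LocalRing L v))).det) ^ (N - 1)) w)) = 1 := by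
  simp only [sub_zero, add_zero, Matrix.det_one, mul_one, one_pow, Pi.one_apply, map_one, Finset.prod_const_one]

/-! ## §2 The weight along the central Cayley slice: `‖u‖ · Π|a_w| = Π|2^{N(N−1)}|·Π|disc(χ_Y)_w|` -/

omit [IsCMField L] in
/-- **The socket's module `‖u‖` at `y = z·c(Y)`**: if `u·det(z·c(Y))^{N−1} = disc(χ_{z·c(Y)})` with `1 − Y` invertible then
`‖u‖ · Π_w |((det(1−Y)det(1+Y))^{N−1})_w|_w = Π_w |(2^{N(N−1)})_w|_w · Π_w |disc(χ_Y)_w|_w` (★ `unit_mul_det_pow_eq_of_smul_cayley`, ★ `unitModulusChar_localRing_eq_prod`,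
multiplicativity of `|·|_w`). [cite: HarishChandra1999AdmissibleDistributions, §17] -/
theorem unitModulusChar_mul_detFactor_eq (Y : Matrix (Fin N) (Fin N) (UnitaryGroup.LocalRing L v)) (hY : IsUnit (1 - Y)) (z : (UnitaryGroup.LocalRing L v)ˣ) (u : (UnitaryGroup.LocalRing L v)ˣ)
    (hu : (u : UnitaryGroup.LocalRing L v) * ((z : UnitaryGroup.LocalRing L v) • ((1 + Y) * (1 - Y)⁻¹)).det ^ (N - 1) = ((z : UnitaryGroup.LocalRing L v) • ((1 + Y) * (1 - Y)⁻¹)).charpoly.discr) :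
    unitModulusChar (UnitaryGroup.LocalRing L v) u * ∏ w : PlacesOver L v, normAbs (w.1.adicCompletion L) ((((1 - Y).det * (1 + Y).det) ^ (N - 1)) w) =
      (∏ w : PlacesOver L v, normAbs (w.1.adicCompletion L) (((2 : UnitaryGroup.LocalRing L v) ^ (N * (N - 1))) w)) *
        ∏ w : PlacesOver L v, normAbs (w.1.adicCompletion L) ((Y.charpoly.discr) w) := by
  have hid := unit_mul_det_pow_eq_of_smul_cayley Y ((Matrix.isUnit_iff_isUnit_det _).1 hY) z (u : UnitaryGroup.LocalRing L v) hu
  rw [unitModulusChar_localRing_eq_prod L v u, ← Finset.prod_mul_distrib, ← Finset.prod_mul_distrib]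
  refine Finset.prod_congr rfl fun w _ => ?_
  rw [← map_mul, ← map_mul, ← Pi.mul_apply, ← Pi.mul_apply, hid]

/-! ## §3 The composition: socket #12 at a central point from the Lie-algebra bound and the central Cayley covering -/

set_option maxHeartbeats 1600000 in
/-- **Socket #12 at a CENTRAL point `s` (`matrix(s) = z·1`) from (i) the Lie-algebra bound along the Cayley slice and (ii) the central Cayley covering.**
(i) is Harish-Chandra's Thm 16.2 + Cor 6.2 on `𝔤 = 𝔲_N` in the weight `|disc(χ_Y)|^{1∕4}` (the group weight has been divided out by ★ `unit_mul_det_pow_eq_of_smul_cayley`);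
(ii) is the inverse Cayley chart at `s` (file `K2E3CayleySliceCoversNhdsCentral`).  Proof: shrink `V` so that `Π_w|((det(1−Y)det(1+Y))^{N−1})_w| > 1∕2` (§1), take the slice
`S = {y | ∃ Y ∈ V′, skew, [s,Y]=0, 1±Y units, y = s·c(Y)}` in ★ `normalizedCharBddNear_of_slice` (conjugator `x = 1`), and bound `√√‖u‖·‖Θ y‖ ≤ √√(2·Π|2^{N(N−1)}|)·B` by §2.
[cite: HarishChandra1999AdmissibleDistributions, Thm. 16.3 p. 77; §17; §21 p. 87] [cite: Rogawski1990, §12.7 p. 193] -/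
theorem normalizedCharBddNear_central_of_lieBound
    [MeasurableSpace ((UnitaryGroup.cmDatum L N H).Local v)] [BorelSpace ((UnitaryGroup.cmDatum L N H).Local v)] (μ : Measure ((UnitaryGroup.cmDatum L N H).Local v)) [μ.IsHaarMeasure]
    (c : IrrClass ((UnitaryGroup.cmDatum L N H).Local v)) (Θ : (UnitaryGroup.cmDatum L N H).Local v → ℂ)
    (hloc : ∀ x : (UnitaryGroup.cmDatum L N H).Local v, IsRegularElt (x.val : GL (Fin N) (UnitaryGroup.LocalRing L v)) → ∀ᶠ y in 𝓝 x, Θ y = Θ x)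
    (hrep : ∀ φ : (UnitaryGroup.cmDatum L N H).Local v → ℂ, IsLocSmooth φ → c.smoothTrace μ φ = ∫ x, φ x * Θ x ∂μ)
    (s : (UnitaryGroup.cmDatum L N H).Local v) (z : (UnitaryGroup.LocalRing L v)ˣ) (hz : ((s.val : GL (Fin N) (UnitaryGroup.LocalRing L v)).val : Matrix (Fin N) (Fin N) (UnitaryGroup.LocalRing L v)) = (z : UnitaryGroup.LocalRing L v) • (1 : Matrix (Fin N) (Fin N) (UnitaryGroup.LocalRing L v)))
    (hLie : ∃ V : Set (Matrix (Fin N) (Fin N) (UnitaryGroup.LocalRing L v)), V ∈ 𝓝 (0 : Matrix (Fin N) (Fin N) (UnitaryGroup.LocalRing L v)) ∧ ∃ B : ℝ, ∀ y : (UnitaryGroup.cmDatum L N H).Local v, ∀ Y ∈ V,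
        (Y.map (UnitaryGroup.conjLocal L (IsCMField.complexConj L) v))ᵀ * ((UnitaryGroup.adelicForm L N H).map (UnitaryGroup.adeleToLocal L v)) = -(((UnitaryGroup.adelicForm L N H).map (UnitaryGroup.adeleToLocal L v)) * Y) →
        ((s.val : GL (Fin N) (UnitaryGroup.LocalRing L v)).val : Matrix (Fin N) (Fin N) (UnitaryGroup.LocalRing L v)) * Y = Y * ((s.val : GL (Fin N) (UnitaryGroup.LocalRing L v)).val : Matrix (Fin N) (Fin N) (UnitaryGroup.LocalRing L v)) → IsUnit (1 - Y) → IsUnit (1 + Y) →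
        ((y.val : GL (Fin N) (UnitaryGroup.LocalRing L v)).val : Matrix (Fin N) (Fin N) (UnitaryGroup.LocalRing L v)) = ((s.val : GL (Fin N) (UnitaryGroup.LocalRing L v)).val : Matrix (Fin N) (Fin N) (UnitaryGroup.LocalRing L v)) * ((1 + Y) * (1 - Y)⁻¹) →
        ((NNReal.sqrt (NNReal.sqrt (∏ w : PlacesOver L v, normAbs (w.1.adicCompletion L) ((Y.charpoly.discr) w))) : ℝ≥0) : ℝ) * ‖Θ y‖ ≤ B)
    (hcov : ∀ V : Set (Matrix (Fin N) (Fin N) (UnitaryGroup.LocalRing L v)), V ∈ 𝓝 (0 : Matrix (Fin N) (Fin N) (UnitaryGroup.LocalRing L v)) →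
        ∃ U : Set ((UnitaryGroup.cmDatum L N H).Local v), IsOpen U ∧ s ∈ U ∧ ∀ g ∈ U, ∃ Y ∈ V,
          (Y.map (UnitaryGroup.conjLocal L (IsCMField.complexConj L) v))ᵀ * ((UnitaryGroup.adelicForm L N H).map (UnitaryGroup.adeleToLocal L v)) = -(((UnitaryGroup.adelicForm L N H).map (UnitaryGroup.adeleToLocal L v)) * Y) ∧
          ((s.val : GL (Fin N) (UnitaryGroup.LocalRing L v)).val : Matrix (Fin N) (Fin N) (UnitaryGroup.LocalRing L v)) * Y = Y * ((s.val : GL (Fin N) (UnitaryGroup.LocalRing L v)).val : Matrix (Fin N) (Fin N) (UnitaryGroup.LocalRing L v)) ∧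
          IsUnit (1 - Y) ∧ IsUnit (1 + Y) ∧
          ((g.val : GL (Fin N) (UnitaryGroup.LocalRing L v)).val : Matrix (Fin N) (Fin N) (UnitaryGroup.LocalRing L v)) = ((s.val : GL (Fin N) (UnitaryGroup.LocalRing L v)).val : Matrix (Fin N) (Fin N) (UnitaryGroup.LocalRing L v)) * ((1 + Y) * (1 - Y)⁻¹)) :
    ∃ U : Set ((UnitaryGroup.cmDatum L N H).Local v), IsOpen U ∧ s ∈ U ∧
      ∃ B : ℝ, ∀ g ∈ U, ∀ u : (UnitaryGroup.LocalRing L v)ˣ,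
        (u : UnitaryGroup.LocalRing L v) *
            (((g.val : GL (Fin N) (UnitaryGroup.LocalRing L v)) : Matrix (Fin N) (Fin N) (UnitaryGroup.LocalRing L v)).det) ^ (N - 1) =
          (((g.val : GL (Fin N) (UnitaryGroup.LocalRing L v)) : Matrix (Fin N) (Fin N) (UnitaryGroup.LocalRing L v)).charpoly).discr →
        ((NNReal.sqrt (NNReal.sqrt (unitModulusChar (UnitaryGroup.LocalRing L v) u)) : ℝ≥0) : ℝ) * ‖Θ g‖ ≤ B := by
  obtain ⟨V, hV, B, hB⟩ := hLie
  -- the unit factor and its lower bound `1∕2` near `0`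
  set Mf : Matrix (Fin N) (Fin N) (UnitaryGroup.LocalRing L v) → ℝ≥0 := fun Y =>
    ∏ w : PlacesOver L v, normAbs (w.1.adicCompletion L) ((((1 - Y).det * (1 + Y).det) ^ (N - 1)) w) with hMf
  have hMc : Continuous Mf := continuous_detFactor L N v
  have hM0 : Mf 0 = 1 := detFactor_zero L N v
  have hVM : Mf ⁻¹' Set.Ioi (1 / 2) ∈ 𝓝 (0 : Matrix (Fin N) (Fin N) (UnitaryGroup.LocalRing L v)) := by
    refine (hMc.isOpen_preimage _ isOpen_Ioi).mem_nhds ?_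
    rw [Set.mem_preimage, hM0, Set.mem_Ioi]
    exact one_half_lt_one
  set V' : Set (Matrix (Fin N) (Fin N) (UnitaryGroup.LocalRing L v)) := V ∩ Mf ⁻¹' Set.Ioi (1 / 2) with hV'
  have hV'n : V' ∈ 𝓝 (0 : Matrix (Fin N) (Fin N) (UnitaryGroup.LocalRing L v)) := Filter.inter_mem hV hVM
  obtain ⟨U, hUo, hsU, hU⟩ := hcov V' hV'n
  -- the constant `K = Π_w |2^{N(N−1)}|_w` and the final bound
  set K : ℝ≥0 := ∏ w : PlacesOver L v, normAbs (w.1.adicCompletion L) (((2 : UnitaryGroup.LocalRing L v) ^ (N * (N - 1))) w) with hK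
  set B' : ℝ := ((NNReal.sqrt (NNReal.sqrt (2 * K)) : ℝ≥0) : ℝ) * max B 0 with hB'
  refine normalizedCharBddNear_of_slice L N H v μ c Θ hloc hrep s
    {y : (UnitaryGroup.cmDatum L N H).Local v | ∃ Y ∈ V', (Y.map (UnitaryGroup.conjLocal L (IsCMField.complexConj L) v))ᵀ * ((UnitaryGroup.adelicForm L N H).map (UnitaryGroup.adeleToLocal L v)) = -(((UnitaryGroup.adelicForm L N H).map (UnitaryGroup.adeleToLocal L v)) * Y) ∧
        ((s.val : GL (Fin N) (UnitaryGroup.LocalRing L v)).val : Matrix (Fin N) (Fin N) (UnitaryGroup.LocalRing L v)) * Y = Y * ((s.val : GL (Fin N) (UnitaryGroup.LocalRing L v)).val : Matrix (Fin N) (Fin N) (UnitaryGroup.LocalRing L v)) ∧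
        IsUnit (1 - Y) ∧ IsUnit (1 + Y) ∧
        ((y.val : GL (Fin N) (UnitaryGroup.LocalRing L v)).val : Matrix (Fin N) (Fin N) (UnitaryGroup.LocalRing L v)) = ((s.val : GL (Fin N) (UnitaryGroup.LocalRing L v)).val : Matrix (Fin N) (Fin N) (UnitaryGroup.LocalRing L v)) * ((1 + Y) * (1 - Y)⁻¹)}
    ⟨B', ?_⟩ ⟨U, hUo, hsU, fun g hg _ => ⟨1, by rw [one_mul, inv_one, mul_one]; exact hU g hg⟩⟩
  rintro y ⟨Y, hYV', hskew, hcomm, h1, h2, hy⟩ u hu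
  have hYV : Y ∈ V := hYV'.1
  have hYM : 1 / 2 < Mf Y := hYV'.2
  -- the unit relation at `y = z • c(Y)`
  have hyz : ((y.val : GL (Fin N) (UnitaryGroup.LocalRing L v)).val : Matrix (Fin N) (Fin N) (UnitaryGroup.LocalRing L v)) = (z : UnitaryGroup.LocalRing L v) • ((1 + Y) * (1 - Y)⁻¹) := by
    rw [hy, hz, Matrix.smul_mul, Matrix.one_mul]
  have hu' : (u : UnitaryGroup.LocalRing L v) * ((z : UnitaryGroup.LocalRing L v) • ((1 + Y) * (1 - Y)⁻¹)).det ^ (N - 1) = ((z : UnitaryGroup.LocalRing L v) • ((1 + Y) * (1 - Y)⁻¹)).charpoly.discr := by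
    rw [← hyz]; exact hu
  have hmod := unitModulusChar_mul_detFactor_eq L N v Y h1 z u hu'
  -- `‖u‖ ≤ 2 K D`
  set D : ℝ≥0 := ∏ w : PlacesOver L v, normAbs (w.1.adicCompletion L) ((Y.charpoly.discr) w) with hD
  have hle : unitModulusChar (UnitaryGroup.LocalRing L v) u ≤ 2 * K * D := by
    have h2 : unitModulusChar (UnitaryGroup.LocalRing L v) u * (1 / 2) ≤ unitModulusChar (UnitaryGroup.LocalRing L v) u * Mf Y :=
      mul_le_mul_of_nonneg_left hYM.le (zero_le)
    rw [hmod] at h2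
    calc unitModulusChar (UnitaryGroup.LocalRing L v) u = unitModulusChar (UnitaryGroup.LocalRing L v) u * (1 / 2) * 2 := by rw [mul_assoc, one_div, inv_mul_cancel₀ (two_ne_zero), mul_one]
      _ ≤ K * D * 2 := mul_le_mul_of_nonneg_right h2 (zero_le)
      _ = 2 * K * D := by ring
  have hsqrt : NNReal.sqrt (NNReal.sqrt (unitModulusChar (UnitaryGroup.LocalRing L v) u)) ≤ NNReal.sqrt (NNReal.sqrt (2 * K)) * NNReal.sqrt (NNReal.sqrt D) := by
    rw [← NNReal.sqrt_mul, ← NNReal.sqrt_mul]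
    exact NNReal.sqrt_le_sqrt.2 (NNReal.sqrt_le_sqrt.2 hle)
  have hLie := hB y Y hYV hskew hcomm h1 h2 hy
  have hB0 : B ≤ max B 0 := le_max_left _ _
  have hW0 : 0 ≤ ((NNReal.sqrt (NNReal.sqrt D) : ℝ≥0) : ℝ) * ‖Θ y‖ := mul_nonneg (NNReal.coe_nonneg _) (norm_nonneg _)
  calc ((NNReal.sqrt (NNReal.sqrt (unitModulusChar (UnitaryGroup.LocalRing L v) u)) : ℝ≥0) : ℝ) * ‖Θ y‖
      ≤ (((NNReal.sqrt (NNReal.sqrt (2 * K)) * NNReal.sqrt (NNReal.sqrt D) : ℝ≥0)) : ℝ) * ‖Θ y‖ :=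
        mul_le_mul_of_nonneg_right (NNReal.coe_le_coe.2 hsqrt) (norm_nonneg _)
    _ = ((NNReal.sqrt (NNReal.sqrt (2 * K)) : ℝ≥0) : ℝ) * ((((NNReal.sqrt (NNReal.sqrt D)) : ℝ≥0) : ℝ) * ‖Θ y‖) := by
        rw [NNReal.coe_mul, mul_assoc]
    _ ≤ ((NNReal.sqrt (NNReal.sqrt (2 * K)) : ℝ≥0) : ℝ) * max B 0 :=
        mul_le_mul_of_nonneg_left (hLie.trans hB0) (NNReal.coe_nonneg _)

end Summit.HodgeConjecture.HodgeConjecture.Cruxes.H413.K2E3NormalizedCharBddNearCentralOfLieBound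

end
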